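import Summits.QuantumFields.YangMills.Theorems.BalabanUVNodesK3V5Defs

/-!
# Route «BalabanUVNodes», crux K3⁸ `SpineGivenEndpointR13SepCoPHV` (stmt-QuantumFields-27366), node N16 = NE3 — LOCATED-N16-TUNED-WITNESS, KERNEL CERTIFICATE:
# the registered guard `GuardedReadingN16` (K3⁸ v7 = K3⁷ v5 texts, `Thm/…K3V5Defs` :143) reads N16's Hölder constant `(ℓ₃ F).Λ₂'` ONLY through the sign row
# `0 < (ℓ₃ F).Λ₂'` of `N16LettersEnd` (`Thm/…N16PinnedLayer13CoPH` :114), so the class of pinned readings is CLOSED UNDER `Λ₂' ↦ t` for every positive `t`, while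
# N16's conjunct `N16HolderAt … β` (`Thm/…N16HolderDefs` :194, :69) carries `Λ₂'` as the constant of its (Lip₂′ᶜ) row.  CONSEQUENCE (§3): the corner-free ∀-dial
# sentence of STANDING RULE NE-PIN №239 (4)(ii) for N16 — «the N16 conjunct at EVERY reading carrying the registered pin» — implies the (Lip₂′ᶜ) row AT EVERY POSITIVE
# CONSTANT `t` (second covariant differences of the root below `t·ξ^{2+β}` for all `t > 0`).  N16 is a TUNED-WITNESS node: its bookable sentence is the ∃-dial one
# (modules 45 §2 ∕ 59g: `∃ ℓ₃ g B, rows ∧ ∀ 𝔯 pinned there, N16HolderAtReading 𝔯 β`), never the ∀-dial one of N15 ∕ N21.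

Cell `pub-ymgap`, seat `pub-ymgap-dag-n16-e` (R134 (a), s2), generation 29.  EVIDENCE on stmt-QuantumFields-27366 (count-neutral; kernel bookkeeping; 0 `sorry`; nothing of
Bałaban asserted; no stub proved; N16 NOT discharged; K3⁸ v7 0∕2; COUNT 8∕27 UNMOVED).  One finite 𝕋⁴ programme at fixed ε — NOT ℝ⁴ ∕ OS ∕ mass gap ∕ Clay.
-/

set_option autoImplicit false

namespace Summit.QuantumFields.YangMills.BalabanUVNodes.N16DialScaling

open Literature.MathematicalPhysics.QuantumFieldTheory.Balaban1983to89
open Literature.MathematicalPhysics.QuantumFieldTheory.Balaban1983to89.T4Continuum (T4Family ULoop)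
open Node00 (Stage13HParams NE3Letters₁₁ ne3ConstLayerOfRecord₁₁ ne3NperOfRecord₁₁ ne3DomOfRecord₁₁)
open Summit.QuantumFields.BalabanUV.T4Continuum
open MinimalActionRate (sfClass)
open YMDAG.UVSplit (ne3OfRecord₁₁ RateReading₁₃CoPH rateCarriersOfRecord₁₃CoPH)
open Summit.QuantumFields.YangMills.BalabanUVNodes.N16HolderDefs (CovRootHolder N16HolderAt)
open Summit.QuantumFields.YangMills.BalabanUVNodes.N16PinnedLayer13CoPH (N16PinnedLoose N16LettersEnd N16HolderAtReading n16HolderAtReading_iff_of_pinnedLoose)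
open Summit.QuantumFields.YangMills.BalabanUVNodes.N16HolderRegime (InEndRegimeH)
open Summit.QuantumFields.YangMills.Theorems.K3V5Defs (RunSel LetterReading GuardedReading GuardedReadingN16 N16RadiusMatch)

noncomputable section

/-! ## §1 The Λ₂'-rescaled dial and the guard rows -/

/-- The letter reading `ℓ₃` with its Hölder constant replaced by `t F` (all other letters kept). [bookkeeping] -/
def rescaleHolder (ℓ₃ : T4Family → NE3Letters₁₁) (t : T4Family → ℝ) : T4Family → NE3Letters₁₁ :=
  fun F => { ℓ₃ F with Λ₂' := t F }

/-- Face (`rfl`). [bookkeeping] -/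
theorem rescaleHolder_Λ₂' (ℓ₃ : T4Family → NE3Letters₁₁) (t : T4Family → ℝ) (F : T4Family) : (rescaleHolder ℓ₃ t F).Λ₂' = t F := rfl
/-- Face (`rfl`). [bookkeeping] -/
theorem rescaleHolder_ε (ℓ₃ : T4Family → NE3Letters₁₁) (t : T4Family → ℝ) (F : T4Family) : (rescaleHolder ℓ₃ t F).ε = (ℓ₃ F).ε := rfl
/-- Face (`rfl`). [bookkeeping] -/
theorem rescaleHolder_b (ℓ₃ : T4Family → NE3Letters₁₁) (t : T4Family → ℝ) (F : T4Family) : (rescaleHolder ℓ₃ t F).b = (ℓ₃ F).b := rfl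

/-- **THE END's LETTER ROWS DO NOT PIN `Λ₂'`**: `N16LettersEnd N g ℓ₃` survives `Λ₂' ↦ t` for every positive `t` (the rows read `Λ₂'` only through `0 < Λ₂'`;
`InEndRegimeH` reads `L, Nper, g, ε, Λ₁, b, C`). [bookkeeping] -/
theorem n16LettersEnd_rescaleHolder {N : ℕ} [NeZero N] {g : T4Family → ℝ} {ℓ₃ : T4Family → NE3Letters₁₁} (h : N16LettersEnd N g ℓ₃)
    {t : T4Family → ℝ} (ht : ∀ F, 0 < t F) : N16LettersEnd N g (rescaleHolder ℓ₃ t) := by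
  intro F
  obtain ⟨h1, h2, h3, h4, h5, -, h7⟩ := h F
  exact ⟨h1, h2, h3, h4, h5, ht F, h7⟩

/-- **THE RADIUS-MATCH ROW DOES NOT READ `Λ₂'`** (`Iff.rfl`-level). [bookkeeping] -/
theorem n16RadiusMatch_rescaleHolder {ℓ₃ : T4Family → NE3Letters₁₁} {B : T4Family → ℝ} (h : N16RadiusMatch ℓ₃ B) (t : T4Family → ℝ) :
    N16RadiusMatch (rescaleHolder ℓ₃ t) B := h

/-! ## §2 Readings: re-pinning the NE3 layer at the rescaled dial keeps the v4 guard -/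

/-- The reading `𝔯` with its NE3 layer RE-PINNED LOOSE at the dial `(ℓ₃, B)` (node U3 ∕ N15 ∕ N14 components untouched — module 43's `eraseNE3` pattern). [bookkeeping] -/
def repin (𝔯 : RateReading₁₃CoPH 2) (ℓ₃ : T4Family → NE3Letters₁₁) (B : T4Family → ℝ) : RateReading₁₃CoPH 2 :=
  ⟨fun F θ hP g₀ os => { 𝔯.lit F θ hP g₀ os with ne3 := fun _ =>
      { ne3ConstLayerOfRecord₁₁ F 2 (ℓ₃ F) with
        dom := {V | V ∈ ne3DomOfRecord₁₁ F 2 0 0 ∧ V ∈ sfClass 4 F.L (ne3NperOfRecord₁₁ F 0 0) ((ℓ₃ F).ε / B F) 0} } }, 𝔯.ne1⟩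

/-- The re-pinned reading IS pinned loose at `(ℓ₃, B)` (`rfl`). [bookkeeping] -/
theorem n16PinnedLoose_repin (𝔯 : RateReading₁₃CoPH 2) (ℓ₃ : T4Family → NE3Letters₁₁) (B : T4Family → ℝ) : N16PinnedLoose (repin 𝔯 ℓ₃ B) ℓ₃ B :=
  fun _ _ _ _ _ _ => rfl

/-- **THE v4 GUARD DOES NOT READ THE NE3 LAYER**: `GuardedReading` (N14 pin, keyed N15 liveness, (α-N15) pin, node-U3 pin) transfers to the re-pinned reading verbatim. [bookkeeping] -/
theorem guardedReading_repin {𝔯 : RateReading₁₃CoPH 2} {ksel : RunSel} {ℓ : LetterReading} (h : GuardedReading 𝔯 ksel ℓ)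
    (ℓ₃ : T4Family → NE3Letters₁₁) (B : T4Family → ℝ) : GuardedReading (repin 𝔯 ℓ₃ B) ksel ℓ := h

/-- **THE CLASS OF PINNED READINGS IS CLOSED UNDER `Λ₂' ↦ t > 0`**: from ANY reading carrying the registered pin at dial `(ℓ₃, g, B)`, the re-pinned reading at the rescaled
dial `(ℓ₃[Λ₂' := t], g, B)` carries it too. [bookkeeping] -/
theorem guardedReadingN16_repin_rescaleHolder {𝔯 : RateReading₁₃CoPH 2} {ksel : RunSel} {ℓ : LetterReading} {ℓ₃ : T4Family → NE3Letters₁₁} {g B : T4Family → ℝ}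
    (h : GuardedReadingN16 𝔯 ksel ℓ ℓ₃ g B) {t : T4Family → ℝ} (ht : ∀ F, 0 < t F) :
    GuardedReadingN16 (repin 𝔯 (rescaleHolder ℓ₃ t) B) ksel ℓ (rescaleHolder ℓ₃ t) g B :=
  ⟨guardedReading_repin h.1 _ _, n16PinnedLoose_repin 𝔯 _ B, n16LettersEnd_rescaleHolder h.2.2.1 ht, n16RadiusMatch_rescaleHolder h.2.2.2 t⟩

/-! ## §3 The ∀-dial sentence for N16 and what it asserts -/

/-- **THE CORNER-FREE ∀-DIAL SENTENCE OF NE-PIN (ii) FOR N16 AT PIN v7** — «N16's conjunct at EVERY reading carrying `GuardedReadingN16`» (N15's kernel-fact shape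
`n15At_rrOfRecord_of_guardedReadingN16` with `N15At ↦ N16HolderAt · β`).  Defined here to be ANALYSED, not claimed. [bookkeeping] -/
def ForallDialN16 (β : ℝ) : Prop :=
  ∀ (𝔯 : RateReading₁₃CoPH 2) (ksel : RunSel) (ℓ : LetterReading) (ℓ₃ : T4Family → NE3Letters₁₁) (g B : T4Family → ℝ),
    GuardedReadingN16 𝔯 ksel ℓ ℓ₃ g B → N16HolderAtReading 𝔯 β

/-- **★ THE ∀-DIAL SENTENCE PUTS N16's (Lip₂′ᶜ) ROW AT EVERY POSITIVE CONSTANT**: under `ForallDialN16 β`, every reading carrying the pin at dial `(ℓ₃, g, B)`, every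
positive `t`, every Stage-13 tuple with core provisos, `g₀`, `os`: the covariant root of EVERY constrained-minimiser pair of the pinned class satisfies the energy and
(Lip₁ᶜ) rows at the pinned constants AND the (Lip₂′ᶜ) row `‖…‖ ≤ t F · ξ^{2+β}` — i.e. `CovRootHolder` with `Λ₂' := t F`, `t F > 0` ARBITRARY.  (The by-name road feeds
the Hölder row only at `Λ₂' ≥ B_h·(α+176α)+…`, `PrintSlotHolder` `Thm/…N16HolderRegime` §1; no content can feed it at every `t`.) [bookkeeping] -/
theorem covRootHolder_every_holderConstant_of_forallDial {β : ℝ} (H : ForallDialN16 β)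
    {𝔯 : RateReading₁₃CoPH 2} {ksel : RunSel} {ℓ : LetterReading} {ℓ₃ : T4Family → NE3Letters₁₁} {g B : T4Family → ℝ}
    (h : GuardedReadingN16 𝔯 ksel ℓ ℓ₃ g B) {t : T4Family → ℝ} (ht : ∀ F, 0 < t F)
    (F : T4Family) (θ : Stage13HParams F 2) (hP : θ.Provisos₁₃CoPH F 2) (g₀ : ℕ → ℝ) (os : List (ULoop F)) (k : ℕ) :
    CovRootHolder 4 (sfClass 4 F.L (ne3NperOfRecord₁₁ F 0 0) (ℓ₃ F).ε) F.L (ne3NperOfRecord₁₁ F 0 0) (ℓ₃ F).b (ℓ₃ F).g (ℓ₃ F).C (ℓ₃ F).Λ₁ (t F) β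
      {V | V ∈ ne3DomOfRecord₁₁ F 2 0 0 ∧ V ∈ sfClass 4 F.L (ne3NperOfRecord₁₁ F 0 0) ((ℓ₃ F).ε / B F) 0} := by
  have h' := H _ ksel ℓ _ g B (guardedReadingN16_repin_rescaleHolder h ht) F θ hP g₀ os k
  exact h'

/-- **★ COROLLARY — THE (Lip₂′ᶜ) ROW AT EVERY POSITIVE CONSTANT, ONE READING FIXED**: under `ForallDialN16 β`, at any reading carrying the pin and any Stage-13 tuple with
core provisos, N16's covariant-root sentence holds with the Hölder constant replaced by EVERY `t > 0` (class, data, energy and (Lip₁ᶜ) constants unchanged). [bookkeeping] -/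
theorem covRootHolder_forall_pos_of_forallDial {β : ℝ} (H : ForallDialN16 β)
    {𝔯 : RateReading₁₃CoPH 2} {ksel : RunSel} {ℓ : LetterReading} {ℓ₃ : T4Family → NE3Letters₁₁} {g B : T4Family → ℝ}
    (h : GuardedReadingN16 𝔯 ksel ℓ ℓ₃ g B)
    (F : T4Family) (θ : Stage13HParams F 2) (hP : θ.Provisos₁₃CoPH F 2) (g₀ : ℕ → ℝ) (os : List (ULoop F)) :
    ∀ t : ℝ, 0 < t →
      CovRootHolder 4 (sfClass 4 F.L (ne3NperOfRecord₁₁ F 0 0) (ℓ₃ F).ε) F.L (ne3NperOfRecord₁₁ F 0 0) (ℓ₃ F).b (ℓ₃ F).g (ℓ₃ F).C (ℓ₃ F).Λ₁ t β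
        {V | V ∈ ne3DomOfRecord₁₁ F 2 0 0 ∧ V ∈ sfClass 4 F.L (ne3NperOfRecord₁₁ F 0 0) ((ℓ₃ F).ε / B F) 0} :=
  fun t ht => covRootHolder_every_holderConstant_of_forallDial H h (t := fun _ => t) (fun _ => ht) F θ hP g₀ os 0

/-! ## §4 The sentence N16 CAN carry: the tuned-witness (∃-dial) form -/

/-- **THE TUNED-WITNESS (∃-DIAL) SENTENCE FOR N16 AT PIN v7**: SOME admissible dial `(ℓ₃, g, B)` (THE END's rows + the radius match) such that EVERY reading pinned loose
there satisfies N16's conjunct at every tuple and run length.  This is the shape the tree's producers conclude modulo the displayed in-edges (module 45 §2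
`…N16PinnedLooseMatch.exists_letters_n16HolderAtReading_loose_of_h5_thm1At_match` in `h5`∕Theorem-1 currency; module 43 §4; modules 57 §3 ∕ 59 ∕ 59g ✓p691995 in
`hE`∕`hN05` + slot-key currency), the dial being TUNED against node N05's Theorem-4 constants `(c₁, B, B_h)` and node N07's `(B₃, B₄, a₁)`.  Defined for the record; not
claimed here. [bookkeeping] -/
def WitnessDialN16 (β : ℝ) : Prop :=
  ∃ (ℓ₃ : T4Family → NE3Letters₁₁) (g B : T4Family → ℝ), N16LettersEnd 2 g ℓ₃ ∧ N16RadiusMatch ℓ₃ B ∧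
    ∀ 𝔯 : RateReading₁₃CoPH 2, N16PinnedLoose 𝔯 ℓ₃ B → N16HolderAtReading 𝔯 β

/-- **THE ∀-DIAL SENTENCE IMPLIES THE WITNESS SENTENCE AS SOON AS ONE ADMISSIBLE DIAL AND ONE v4-GUARDED READING EXIST** (the converse is the content of §3: it fails by
scaling).  [bookkeeping] -/
theorem witnessDial_of_forallDial {β : ℝ} (H : ForallDialN16 β)
    {𝔯 : RateReading₁₃CoPH 2} {ksel : RunSel} {ℓ : LetterReading} (h𝔯 : GuardedReading 𝔯 ksel ℓ)
    {ℓ₃ : T4Family → NE3Letters₁₁} {g B : T4Family → ℝ} (hE : N16LettersEnd 2 g ℓ₃) (hM : N16RadiusMatch ℓ₃ B) :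
    WitnessDialN16 β := by
  refine ⟨ℓ₃, g, B, hE, hM, fun 𝔯' hpin => ?_⟩
  -- the re-pinned reading of `𝔯` at `(ℓ₃, B)` carries the full pin (its N14 ∕ N15 ∕ U3 layers are `𝔯`'s); its NE3 layer is `𝔯'`'s by the two pin equations,
  -- and module 43's reading face moves the conjunct across.
  have hG : GuardedReadingN16 (repin 𝔯 ℓ₃ B) ksel ℓ ℓ₃ g B := ⟨guardedReading_repin h𝔯 _ _, n16PinnedLoose_repin 𝔯 _ B, hE, hM⟩
  exact (n16HolderAtReading_iff_of_pinnedLoose β hpin).2 fun F hex =>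
    (n16HolderAtReading_iff_of_pinnedLoose β (n16PinnedLoose_repin 𝔯 ℓ₃ B)).1 (H _ ksel ℓ _ g B hG) F hex

end

end Summit.QuantumFields.YangMills.BalabanUVNodes.N16DialScaling
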